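import Literature.Computability.AlgebraicComplexity.Shafiei15ApolarIdealsDetPerm
import Literature.Computability.AlgebraicComplexity.StandardFamiliesProofs
import Literature.RingTheory.MvPolynomial.HomogeneousHilbertFunction
import HarnessLib

/-!
# Shafiei 2015, §3: the Ranestad–Schreyer length bound for Waring decompositions, and
# `r(det_n), r(perm_n) ≥ ½ binom(2n, n)`

Topic `Literature/Computability/AlgebraicComplexity`; sequel of `Shafiei15ApolarIdealsDetPerm.lean`
(§§1–2: `Ann(det_n)`, `Ann(perm_n)` generated by quadrics, Hilbert function `binom(n,k)²`, length
`binom(2n,n)`). Source: S. M. Shafiei, *Apolarity for determinants and permanents of generic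
matrices*, J. Commut. Algebra **7** (2015) = arXiv:1212.0515 [`Shafiei2015`], §3 (held
`paper:arxiv-1212.0515`, chunk `p0007`); the bound is K. Ranestad, F.-O. Schreyer, *On the rank of a
symmetric form*, J. Algebra 346 (2011) 340–342 [`RanestadSchreyer2011`], Proposition 1.
Everything is PROVED (no named facts).

## The printed statements (§3, p0007) and what is typed

* **Prop. 3.4 (Ranestad–Schreyer)**: "If the ideal of `Ann(F)` is generated in degree `d` and
  `Γ ⊂ 𝐏(T₁)` is a finite (punctual) apolar subscheme to `F`, then `deg Γ ≥ (1/d) deg(Ann(F))`, where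
  `deg(Ann(F)) = dim(S/Ann(F))` is the length of the 0-dimensional scheme defined by `Ann(F)`."
* **Thm. 3.5**: "Let `F` be the determinant or permanent of a generic `n × n` matrix `A`. We have
  `½ binom(2n,n) ≤ cr(F) ≤ sr(F) ≤ r(F)`" (`cr` cactus rank, `sr` smoothable rank, `r` Waring rank,
  Def. 3.2; Remark 3.1: `F = c₁ℓ₁^d + ⋯ + c_sℓ_s^d` iff `I_Γ ⊂ Ann(F)` for `Γ = {[ℓ₁],…,[ℓ_s]}`).

TYPED AND PROVED here is the **reduced case** `Γ = ` a finite set of points, i.e. the statements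
about the Waring rank `r(F)` (= size of a homogeneous `ΣΛΣ` expression):

| source item | Lean | status |
|---|---|---|
| Rem 3.1 (apolarity of powers; `⇒` of the apolarity lemma) | `apolarAction_linComb_pow`, `apolarAction_eq_zero_of_eval_eq_zero`, `inf_ker_le_idealDegree_annihilatorIdeal` | proved |
| Prop 3.4 [RS], reduced `Γ`, with "generated in degree `δ`" replaced by its use in the printed proof (a form `G ∈ Ann(F)_δ` vanishing at no point of `Γ`) | `finrank_idealDegree_add_ge` (hypersurface-section count), **`sum_hilbertFunction_annihilatorIdeal_le_mul_card`**: `Σ_{t ≤ T} H(S/Ann F; t) ≤ δ·|S|` | proved |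
| Thm 3.5, the inequality `½ binom(2n,n) ≤ r(F)` for `F = det_n, perm_n` | **`choose_le_two_mul_card_of_waring_detPoly`**, **`choose_le_two_mul_card_of_waring_perPoly`** (`binom(2n,n) ≤ 2|S|` for every decomposition `F = Σ_{s∈S} c_s ℓ_s^n`, infinite field), engine `le_two_mul_card_of_waring` | proved |

NOT typed: the cactus-rank / smoothable-rank inequalities of Thm 3.5 and Prop 3.4 for non-reduced
`Γ` (zero-dimensional schemes: saturation, Hilbert polynomials — a different layer), Prop 3.3,
Thm 3.6 / Cor 3.7 (Landsberg–Teitler), Prop 3.8 (Bernardi–Ranestad), Prop 3.9 (monomials),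
Examples 3.10–3.14, Rem 3.15 (asymptotics).

## Proof route (the printed one, made elementary for points)

[RS]: `I_Γ + (G) ⊆ Ann(F)`, so `length S/(I_Γ + (G)) ≥ length S/Ann(F)`, and `G` being a
non-zero-divisor of degree `δ` on the one-dimensional ring `S/I_Γ`, `length S/(I_Γ+(G)) = δ·deg Γ`.
For points: `I_t := {D ∈ S_t : D(ℓ_s) = 0 ∀ s}` (kernel of evaluation), `A_t := Ann(F)_t`
(`idealDegree (annihilatorIdeal F) t`), `H(t) := dim S_t − dim I_t ≤ |S|` (rank of evaluation at
`|S|` points). Then `I_t ⊆ A_t` (apolarity lemma), `G·S_t ⊆ A_{t+δ}`, and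
`I_{t+δ} ∩ G·S_t = G·I_t` because `G(ℓ_s) ≠ 0` (the non-zero-divisor property, here one line), whence
`dim A_{t+δ} + dim I_t ≥ dim I_{t+δ} + dim S_t` (`finrank_idealDegree_add_ge`), i.e.
`h(t+δ) ≤ H(t+δ) − H(t)` with `h(t) = dim S_t − dim A_t`, and `h(t) ≤ H(t)`; summing along residue
classes modulo `δ` telescopes to `Σ_{t ≤ T} h(t) ≤ δ·|S|`. For `det_n`/`perm_n`: `G = Σ_a w_a ∂_a²` is
an unacceptable quadric, hence in `Ann` (Thm 2.12/2.13), and over an infinite field `w` can be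
chosen with `G(ℓ_s) = Σ_a w_a ℓ_{s,a}² ≠ 0` at the finitely many nonzero points (the tree's
subspace-avoidance lemma `exists_mem_forall_notMem_of_forall_not_le`); zero points contribute
nothing and are discarded; `Σ_{t ≤ n} h(t) = binom(2n,n)` is eq. (2.2)
(`sum_hilbertFunction_annihilatorIdeal_detPoly/_perPoly`). Any field works for the count; the
field is assumed infinite only to choose `G`.

Honest framing: a lower bound `½ binom(2n,n)` on the Waring rank (homogeneous `ΣΛΣ` size) that is
THE SAME for `det_n` and `perm_n` (Shafiei, Rem. 3.15) — barrier-side data recorded as an input by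
the route theses `FermionizationDimension` / `SDimPerNotQP` / `ForgivenCollisions`; no progress on
`VP ≠ VNP`.

## References

* S. M. Shafiei, *Apolarity for determinants and permanents of generic matrices*, J. Commut.
  Algebra 7 (2015), §3; arXiv:1212.0515. [`Shafiei2015`]
* K. Ranestad, F.-O. Schreyer, *On the rank of a symmetric form*, J. Algebra 346 (2011) 340–342,
  Proposition 1. [`RanestadSchreyer2011`]
* A. Iarrobino, V. Kanev, *Power sums, Gorenstein algebras, and determinantal loci*, LNM 1721
  (1999), Def. 5.66 (ranks), Lemma 1.15 (apolarity). [`IarrobinoKanev1999`]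
-/

noncomputable section

open MvPolynomial Finset Module

namespace Literature.Computability.AlgebraicComplexity

open Literature.Barriers.ValiantsHypothesis (iterPDeriv iterPDeriv_nil iterPDeriv_cons)
open Literature.RingTheory.MvPolynomial (idealDegree mem_idealDegree finite_homogeneousSubmodule
  finrank_map_mulLeft exists_mem_forall_notMem_of_forall_not_le)

/-! ### Apolarity on powers of linear forms -/

section Powers

variable {σ : Type*} [Fintype σ] {K : Type*} [CommRing K]

/-- `∂_i (Σ_j a_j x_j) = a_i`. [folklore] -/
private theorem pderiv_linComb (a : σ → K) (i : σ) :
    pderiv i (∑ j, C (a j) * X j : MvPolynomial σ K) = C (a i) := by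
  rw [map_sum, Finset.sum_eq_single i]
  · rw [pderiv_C_mul, pderiv_X_self, mul_one]
  · intro j _ hji
    rw [pderiv_C_mul, pderiv_X_of_ne hji, mul_zero]
  · intro h; exact absurd (Finset.mem_univ i) h

/-- Iterated partial derivatives of a power of a linear form `ℓ = Σ_j a_j x_j`:
`∂_{i₁} ⋯ ∂_{i_k} ℓ^d = d(d-1)⋯(d-k+1) · a_{i₁} ⋯ a_{i_k} · ℓ^{d-k}`. [folklore] -/
private theorem iterPDeriv_linComb_pow (a : σ → K) (d : ℕ) (l : List σ) :
    iterPDeriv l ((∑ j, C (a j) * X j : MvPolynomial σ K) ^ d) =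
      C ((d.descFactorial l.length : K) * (l.map a).prod) * (∑ j, C (a j) * X j) ^ (d - l.length) := by
  induction l with
  | nil => simp
  | cons i l ih =>
    rw [iterPDeriv_cons, ih, pderiv_C_mul, Derivation.leibniz_pow, pderiv_linComb, smul_eq_mul,
      List.length_cons, List.map_cons, List.prod_cons, Nat.descFactorial_succ, Nat.sub_succ', nsmul_eq_mul]
    simp only [Nat.cast_mul, map_mul, map_natCast]
    rw [show d - l.length - 0 - 1 = d - (1 + l.length) by omega]
    ring

omit [Fintype σ] in
/-- `(∂_{a₁} ⋯ ∂_{a_r}) ⌟ f` is the iterated partial derivative along the list. [folklore] -/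
private theorem apolarAction_listProd_X' (l : List σ) (f : MvPolynomial σ K) :
    apolarAction (l.map X).prod f = iterPDeriv l f := by
  induction l with
  | nil =>
    rw [List.map_nil, List.prod_nil, iterPDeriv_nil, ← C_1, apolarAction_C, one_smul]
  | cons b l ih =>
    rw [List.map_cons, List.prod_cons, apolarAction_X_mul, ih, apolarAction_X, iterPDeriv_cons]

omit [Fintype σ] in
/-- Every monomial is a product of variables, listed with multiplicity. [folklore] -/
private theorem exists_list_prod_X_eq_monomial' [DecidableEq σ] (e : σ →₀ ℕ) :
    ∃ l : List σ, l.length = e.degree ∧ ((l.map X).prod : MvPolynomial σ K) = monomial e 1 := by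
  induction e using Finsupp.induction with
  | zero => exact ⟨[], by simp, by simp⟩
  | single_add b m f _ _ ih =>
    obtain ⟨l, hl, hprod⟩ := ih
    refine ⟨List.replicate m b ++ l, ?_, ?_⟩
    · rw [List.length_append, List.length_replicate, hl, map_add, Finsupp.degree_single]
    · rw [List.map_append, List.prod_append, hprod, List.map_replicate, List.prod_replicate,
        X_pow_eq_monomial, monomial_mul, one_mul]

/-- **Apolarity on powers of linear forms** (the apolarity lemma behind Shafiei 2015, Remark 3.1 /
[IK] Def. 5.66, [RS]): for `D` homogeneous of degree `k` and `ℓ = Σ_j a_j x_j`,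
`D ⌟ ℓ^d = d(d-1)⋯(d-k+1) · D(a) · ℓ^{d-k}` — the operator acts on `ℓ^d` through its value at the
point `a`. Any commutative ring. [cite: Shafiei2015, Remark 3.1] -/
theorem apolarAction_linComb_pow {D : MvPolynomial σ K} {k : ℕ} (hD : D.IsHomogeneous k)
    (a : σ → K) (d : ℕ) :
    apolarAction D ((∑ j, C (a j) * X j) ^ d) =
      C ((d.descFactorial k : K) * eval a D) * (∑ j, C (a j) * X j) ^ (d - k) := by
  classical
  have key : ∀ e ∈ D.support, apolarAction (monomial e (coeff e D)) ((∑ j, C (a j) * X j) ^ d) =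
      C ((d.descFactorial k : K) * (coeff e D * eval a (monomial e 1))) *
        (∑ j, C (a j) * X j : MvPolynomial σ K) ^ (d - k) := by
    intro e he
    obtain ⟨l, hl, hprod⟩ := exists_list_prod_X_eq_monomial' (K := K) e
    have hdeg : e.degree = k := by
      rw [Finsupp.degree_eq_weight_one]; exact hD (mem_support_iff.1 he)
    have hmono : (monomial e (coeff e D) : MvPolynomial σ K) = coeff e D • (l.map X).prod := by
      rw [hprod, smul_monomial, smul_eq_mul, mul_one]
    have heval : eval a (monomial e (1 : K)) = (l.map a).prod := by
      rw [← hprod, map_list_prod, List.map_map]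
      congr 1
      refine List.map_congr_left fun j _ => ?_
      simp
    rw [hmono, apolarAction_smul_left, apolarAction_listProd_X', iterPDeriv_linComb_pow, hl, hdeg, heval,
      smul_eq_C_mul, ← mul_assoc, ← map_mul]
    congr 2
    ring
  conv_lhs => rw [D.as_sum, apolarAction_sum_left]
  rw [Finset.sum_congr rfl key, ← Finset.sum_mul, ← map_sum]
  congr 2
  rw [← Finset.mul_sum]
  congr 1
  conv_rhs => rw [D.as_sum, map_sum]
  refine Finset.sum_congr rfl fun e _ => ?_
  rw [← mul_one (coeff e D), ← smul_eq_mul (coeff e D) (1 : K), ← smul_monomial, smul_eval, smul_eq_mul, mul_one]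

/-- **Apolarity lemma** (Shafiei 2015, Remark 3.1, easy direction: "`F = c₁ℓ₁^d + ⋯ + c_sℓ_s^d` …
only if `I_Γ ⊂ Ann(F)`"): an operator homogeneous of degree `k` vanishing at all the points `ℓ_s`
annihilates every `F = Σ_s c_s ℓ_s^d`. [cite: Shafiei2015, Remark 3.1] -/
theorem apolarAction_eq_zero_of_eval_eq_zero {S : Type*} [Fintype S] (ℓ : S → σ → K) (c : S → K)
    (d : ℕ) {D : MvPolynomial σ K} {k : ℕ} (hD : D.IsHomogeneous k) (hDℓ : ∀ s, eval (ℓ s) D = 0) :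
    apolarAction D (∑ s, C (c s) * (∑ j, C (ℓ s j) * X j) ^ d) = 0 := by
  rw [apolarAction_sum_right]
  refine Finset.sum_eq_zero fun s _ => ?_
  rw [← smul_eq_C_mul, apolarAction_smul_right, apolarAction_linComb_pow hD, hDℓ s, mul_zero, C_0,
    zero_mul, smul_zero]

end Powers

/-! ### The Ranestad–Schreyer count for a finite set of points -/

section RanestadSchreyer

variable {K : Type*} [Field K] {σ : Type*} [Fintype σ] {S : Type*} [Fintype S]

/-- Submodules of `S_t` are finite-dimensional. [folklore] -/
private theorem finite_of_le_homogeneousSubmodule {V : Submodule K (MvPolynomial σ K)} {t : ℕ}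
    (h : V ≤ homogeneousSubmodule σ K t) : Module.Finite K V := by
  haveI := finite_homogeneousSubmodule (K := K) (σ := σ) t
  exact Module.Finite.of_injective (Submodule.inclusion h) (Submodule.inclusion_injective h)

omit [Fintype S] in
/-- Rank–nullity for the evaluation map at the points on `S_t`:
`dim S_t = dim (S_t ∩ ker ev) + dim ev(S_t)`. [folklore] -/
private theorem finrank_homogeneousSubmodule_eq_ker_add_map
    (ev : MvPolynomial σ K →ₗ[K] (S → K)) (t : ℕ) :
    finrank K (homogeneousSubmodule σ K t) =
      finrank K (↥(homogeneousSubmodule σ K t ⊓ LinearMap.ker ev)) +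
        finrank K ((homogeneousSubmodule σ K t).map ev) := by
  haveI := finite_homogeneousSubmodule (K := K) (σ := σ) t
  have h := LinearMap.finrank_range_add_finrank_ker (ev.domRestrict (homogeneousSubmodule σ K t))
  rw [LinearMap.range_domRestrict, LinearMap.ker_domRestrict] at h
  rw [← h, add_comm, ← Submodule.finrank_map_subtype_eq, Submodule.map_comap_subtype, inf_comm]

omit [Fintype σ] in
/-- The image of `S_t` under evaluation at `|S|` points has dimension `≤ |S|`. [folklore] -/
private theorem finrank_map_le_card (ev : MvPolynomial σ K →ₗ[K] (S → K)) (t : ℕ) :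
    finrank K ((homogeneousSubmodule σ K t).map ev) ≤ Fintype.card S :=
  ((homogeneousSubmodule σ K t).map ev).finrank_le.trans (Module.finrank_pi K).le

variable {F G : MvPolynomial σ K} {d δ : ℕ} (ℓ : S → σ → K) (c : S → K)

/-- **Points impose apolar conditions**: a degree-`t` operator vanishing at every `ℓ_s` annihilates
`F = Σ_s c_s ℓ_s^d`, i.e. `(I_Γ)_t ⊆ Ann(F)_t` (Shafiei 2015, Remark 3.1 / [RS]). [cite: Shafiei2015, Remark 3.1] -/
theorem inf_ker_le_idealDegree_annihilatorIdeal
    (hF : F = ∑ s, C (c s) * (∑ j, C (ℓ s j) * X j) ^ d) (t : ℕ) :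
    homogeneousSubmodule σ K t ⊓
        LinearMap.ker (LinearMap.pi fun s => (MvPolynomial.aeval (ℓ s)).toLinearMap) ≤
      idealDegree (annihilatorIdeal F) t := by
  intro D hD
  obtain ⟨hDt, hDker⟩ := Submodule.mem_inf.1 hD
  rw [mem_homogeneousSubmodule] at hDt
  refine ⟨?_, hDt⟩
  change D ∈ annihilatorIdeal F
  rw [mem_annihilatorIdeal_iff, hF]
  refine apolarAction_eq_zero_of_eval_eq_zero ℓ c d hDt fun s => ?_
  have h := congr_fun (LinearMap.mem_ker.1 hDker) s
  simpa [MvPolynomial.coe_aeval_eq_eval] using h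

/-- **The hypersurface-section count** (the heart of [RS] / Shafiei 2015, Prop. 3.4, for points): with
`I_t := (I_Γ)_t`, `A_t := Ann(F)_t` and a form `G ∈ Ann(F)` of degree `δ` not vanishing at any `ℓ_s`,
`dim A_{t+δ} + dim I_t ≥ dim I_{t+δ} + dim S_t` — because `I_{t+δ} + G·S_t ⊆ A_{t+δ}` and
`I_{t+δ} ∩ G·S_t = G·I_t` (`G` is a non-zero-divisor modulo `I_Γ`). [cite: Shafiei2015, Proposition 3.4] -/
theorem finrank_idealDegree_add_ge (hF : F = ∑ s, C (c s) * (∑ j, C (ℓ s j) * X j) ^ d)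
    (hGhom : G.IsHomogeneous δ) (hGann : G ∈ annihilatorIdeal F) (hG : ∀ s, eval (ℓ s) G ≠ 0)
    (hG0 : G ≠ 0) (t : ℕ) :
    finrank K (↥(homogeneousSubmodule σ K (t + δ) ⊓
        LinearMap.ker (LinearMap.pi fun s => (MvPolynomial.aeval (ℓ s)).toLinearMap))) +
      finrank K (homogeneousSubmodule σ K t) ≤
    finrank K (idealDegree (annihilatorIdeal F) (t + δ)) +
      finrank K (↥(homogeneousSubmodule σ K t ⊓
        LinearMap.ker (LinearMap.pi fun s => (MvPolynomial.aeval (ℓ s)).toLinearMap))) := by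
  classical
  set ev : MvPolynomial σ K →ₗ[K] (S → K) := LinearMap.pi fun s => (MvPolynomial.aeval (ℓ s)).toLinearMap
    with hev
  set St := homogeneousSubmodule σ K t
  set St' := homogeneousSubmodule σ K (t + δ)
  set It := St ⊓ LinearMap.ker ev
  set It' := St' ⊓ LinearMap.ker ev
  set M := St.map (LinearMap.mulLeft K G) with hM
  set A := idealDegree (annihilatorIdeal F) (t + δ)
  have hev_apply : ∀ D s, ev D s = eval (ℓ s) D := by
    intro D s
    simp [hev]
  -- `M ≤ S_{t+δ}` and `M ≤ A`
  have hMle : M ≤ St' := by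
    rintro _ ⟨E, hE, rfl⟩
    rw [SetLike.mem_coe, mem_homogeneousSubmodule] at hE
    rw [LinearMap.mulLeft_apply, mem_homogeneousSubmodule, add_comm]
    exact hGhom.mul hE
  have hMA : M ≤ A := by
    rintro _ ⟨E, hE, rfl⟩
    rw [SetLike.mem_coe, mem_homogeneousSubmodule] at hE
    refine ⟨?_, by rw [add_comm]; exact hGhom.mul hE⟩
    change G * E ∈ annihilatorIdeal F
    exact Ideal.mul_mem_right _ _ hGann
  have hIA : It' ≤ A := inf_ker_le_idealDegree_annihilatorIdeal ℓ c hF (t + δ)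
  -- `I_{t+δ} ∩ M ≤ G · I_t`
  have hinf : It' ⊓ M ≤ It.map (LinearMap.mulLeft K G) := by
    rintro x ⟨hxI, ⟨E, hE, rfl⟩⟩
    refine ⟨E, ⟨hE, ?_⟩, rfl⟩
    rw [SetLike.mem_coe, LinearMap.mem_ker]
    funext s
    have h1 := congr_fun (LinearMap.mem_ker.1 (Submodule.mem_inf.1 hxI).2) s
    rw [hev_apply, LinearMap.mulLeft_apply, map_mul] at h1
    rw [hev_apply]
    simpa [hG s] using h1
  -- finiteness
  haveI : Module.Finite K St := finite_homogeneousSubmodule (K := K) (σ := σ) t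
  haveI : Module.Finite K St' := finite_homogeneousSubmodule (K := K) (σ := σ) (t + δ)
  haveI : Module.Finite K It := finite_of_le_homogeneousSubmodule inf_le_left
  haveI : Module.Finite K It' := finite_of_le_homogeneousSubmodule inf_le_left
  haveI : Module.Finite K M := finite_of_le_homogeneousSubmodule hMle
  haveI : Module.Finite K ↥(It.map (LinearMap.mulLeft K G)) :=
    finite_of_le_homogeneousSubmodule ((Submodule.map_mono inf_le_left).trans hMle)
  -- dimension count
  have h1 : finrank K ↥(It' ⊔ M) ≤ finrank K A := Submodule.finrank_mono (sup_le hIA hMA)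
  have h2 := Submodule.finrank_sup_add_finrank_inf_eq It' M
  have h3 : finrank K ↥(It' ⊓ M) ≤ finrank K It := by
    refine (Submodule.finrank_mono hinf).trans ?_
    rw [finrank_map_mulLeft hG0]
  have h4 : finrank K M = finrank K St := finrank_map_mulLeft hG0 St
  omega

/-- **Ranestad–Schreyer 2011 (Shafiei 2015, Prop. 3.4), reduced case: the length bound for sets
of points apolar to `F`.** "If the ideal of `Ann(F)` is generated in degree `d` and `Γ` is a finite
apolar subscheme to `F`, then `deg Γ ≥ (1/d) deg(Ann(F))`, where `deg(Ann(F)) = dim(S/Ann(F))`."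
Proved here for REDUCED `Γ`, i.e. Waring decompositions `F = Σ_{s ∈ S} c_s ℓ_s^d`, with the
generation hypothesis replaced by what it supplies in the printed proof — a form `G ∈ Ann(F)` of
degree `δ ≥ 1` vanishing at no point `ℓ_s`: then for every `T`,
`Σ_{t ≤ T} (dim S_t − dim Ann(F)_t) ≤ δ · |S|`. (Telescoping the hypersurface-section count; the
scheme-theoretic statement for cactus rank is not typed.) [cite: Shafiei2015, Proposition 3.4]
[cite: RanestadSchreyer2011, Proposition 1] -/
theorem sum_hilbertFunction_annihilatorIdeal_le_mul_card
    (hF : F = ∑ s, C (c s) * (∑ j, C (ℓ s j) * X j) ^ d) (hδ : 1 ≤ δ)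
    (hGhom : G.IsHomogeneous δ) (hGann : G ∈ annihilatorIdeal F) (hG : ∀ s, eval (ℓ s) G ≠ 0)
    (hG0 : G ≠ 0) (T : ℕ) :
    ∑ t ∈ Finset.range (T + 1), (finrank K (homogeneousSubmodule σ K t) -
        finrank K (idealDegree (annihilatorIdeal F) t)) ≤ δ * Fintype.card S := by
  classical
  set ev : MvPolynomial σ K →ₗ[K] (S → K) := LinearMap.pi fun s => (MvPolynomial.aeval (ℓ s)).toLinearMap
    with hev
  -- notation: h t, H t, and the three inequalities
  set h : ℕ → ℕ := fun t => finrank K (homogeneousSubmodule σ K t) -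
    finrank K (idealDegree (annihilatorIdeal F) t) with hh
  set H : ℕ → ℕ := fun t => finrank K ((homogeneousSubmodule σ K t).map ev) with hH
  have hA_le : ∀ t, finrank K (idealDegree (annihilatorIdeal F) t) ≤ finrank K (homogeneousSubmodule σ K t) :=
    fun t => Literature.RingTheory.MvPolynomial.finrank_idealDegree_le _ t
  have hRN : ∀ t, finrank K (homogeneousSubmodule σ K t) =
      finrank K (↥(homogeneousSubmodule σ K t ⊓ LinearMap.ker ev)) + H t :=
    fun t => finrank_homogeneousSubmodule_eq_ker_add_map ev t
  have hI_le : ∀ t, finrank K (↥(homogeneousSubmodule σ K t ⊓ LinearMap.ker ev)) ≤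
      finrank K (idealDegree (annihilatorIdeal F) t) :=
    fun t => Submodule.finrank_mono (inf_ker_le_idealDegree_annihilatorIdeal ℓ c hF t)
  have hHle : ∀ t, H t ≤ Fintype.card S := fun t => finrank_map_le_card ev t
  -- (i) h t ≤ H t
  have hi : ∀ t, h t ≤ H t := by
    intro t
    have := hRN t; have := hI_le t; have := hA_le t
    simp only [hh]; omega
  -- (ii) h (t + δ) + H t ≤ H (t + δ)
  have hii : ∀ t, h (t + δ) + H t ≤ H (t + δ) := by
    intro t
    have h6 := finrank_idealDegree_add_ge ℓ c hF hGhom hGann hG hG0 t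
    rw [← hev] at h6
    have := hRN t; have := hRN (t + δ); have := hA_le (t + δ)
    simp only [hh]; omega
  -- telescoping: Σ_{u < δ (J+1)} h u ≤ Σ_{r < δ} H (r + δ J)
  have tele : ∀ J, ∑ u ∈ Finset.range (δ * (J + 1)), h u ≤ ∑ r ∈ Finset.range δ, H (r + δ * J) := by
    intro J
    induction J with
    | zero =>
      rw [zero_add, mul_one]
      exact Finset.sum_le_sum fun r _ => by rw [mul_zero, add_zero]; exact hi r
    | succ J ih =>
      rw [show δ * (J + 1 + 1) = δ * (J + 1) + δ by ring, Finset.sum_range_add]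
      refine (add_le_add ih le_rfl).trans ?_
      rw [← Finset.sum_add_distrib]
      refine Finset.sum_le_sum fun r _ => ?_
      have := hii (r + δ * J)
      rw [show δ * (J + 1) + r = r + δ * J + δ by ring, show r + δ * (J + 1) = r + δ * J + δ by ring]
      omega
  -- conclude
  calc ∑ t ∈ Finset.range (T + 1), h t
      ≤ ∑ u ∈ Finset.range (δ * (T + 1)), h u :=
        Finset.sum_le_sum_of_subset (Finset.range_subset_range.2 (Nat.le_mul_of_pos_left _ hδ))
    _ ≤ ∑ r ∈ Finset.range δ, H (r + δ * T) := tele T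
    _ ≤ ∑ _r ∈ Finset.range δ, Fintype.card S := Finset.sum_le_sum fun r _ => hHle _
    _ = δ * Fintype.card S := by rw [Finset.sum_const, Finset.card_range, smul_eq_mul]

end RanestadSchreyer

/-! ### Shafiei's Theorem 3.5 (Waring-rank reading) for the determinant and the permanent -/

section DetPerm

variable (K : Type*) [Field K] {S : Type*} [Fintype S]

/-- Over an infinite field, finitely many nonzero points are avoided by some diagonal quadric
`Σ_a w_a ∂_a²` (the transverse element `G ∈ Ann(F)_2` of the Ranestad–Schreyer argument; cf. the
tree's `exists_quadricVal_ne_zero`). [folklore] -/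
private theorem exists_diag_quadric_eval_ne_zero [Infinite K] {σ : Type*} [Fintype σ] [DecidableEq σ]
    (ℓ : S → σ → K) (hℓ : ∀ s, ℓ s ≠ 0) :
    ∃ w : σ → K, ∀ s, ∑ a, w a * (ℓ s a * ℓ s a) ≠ 0 := by
  classical
  let φ : S → ((σ → K) →ₗ[K] K) := fun s => ∑ a, (ℓ s a * ℓ s a) • LinearMap.proj a
  have hφ : ∀ s w, φ s w = ∑ a, w a * (ℓ s a * ℓ s a) := by
    intro s w
    simp only [φ, LinearMap.coe_sum, Finset.sum_apply, LinearMap.smul_apply, LinearMap.coe_proj,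
      Function.eval, smul_eq_mul]
    exact Finset.sum_congr rfl fun a _ => mul_comm _ _
  obtain ⟨w, -, hw⟩ := exists_mem_forall_notMem_of_forall_not_le (⊤ : Submodule K (σ → K))
      (Finset.univ.image fun s => LinearMap.ker (φ s)) (by
        intro W hW hle
        obtain ⟨s, -, rfl⟩ := Finset.mem_image.1 hW
        obtain ⟨a, ha⟩ := Function.ne_iff.1 (hℓ s)
        have hmem : (Pi.single a 1 : σ → K) ∈ LinearMap.ker (φ s) := hle Submodule.mem_top
        rw [LinearMap.mem_ker, hφ, Finset.sum_eq_single a] at hmem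
        · simp only [Pi.single_eq_same, one_mul, mul_self_eq_zero] at hmem
          exact ha hmem
        · intro b _ hba
          rw [Pi.single_eq_of_ne hba, zero_mul]
        · intro h; exact absurd (Finset.mem_univ a) h)
  refine ⟨w, fun s => ?_⟩
  have := hw (LinearMap.ker (φ s)) (Finset.mem_image.2 ⟨s, Finset.mem_univ _, rfl⟩)
  rwa [LinearMap.mem_ker, hφ] at this

/-- **The Ranestad–Schreyer bound for `det_n`-like forms** (engine of Shafiei 2015, Thm. 3.5): if
`F ≠ 0` is killed by every unacceptable quadric (so a diagonal quadric `G = Σ w_a ∂_a² ∈ Ann(F)`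
can be made transverse to any finite point set) and `Σ_{t ≤ n} H(S/Ann F; t) = N`, then every
Waring decomposition `F = Σ_{s ∈ S} c_s ℓ_s^n` over an infinite field has `N ≤ 2 |S|`.
[cite: Shafiei2015, Theorem 3.5] -/
theorem le_two_mul_card_of_waring [Infinite K] {n N : ℕ} {F : MvPolynomial (Fin n × Fin n) K}
    (hF0 : F ≠ 0) (hU : Ideal.span (unacceptableQuadrics n K) ≤ annihilatorIdeal F)
    (hN : ∑ t ∈ Finset.range (n + 1), (finrank K (homogeneousSubmodule (Fin n × Fin n) K t) -
        finrank K (idealDegree (annihilatorIdeal F) t)) = N)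
    (ℓ : S → Fin n × Fin n → K) (c : S → K)
    (h : F = ∑ s, C (c s) * (∑ a, C (ℓ s a) * X a) ^ n) : N ≤ 2 * Fintype.card S := by
  classical
  -- `n = 0`: `N ≤ 1 ≤ 2|S|` since `S` is nonempty (`F ≠ 0`)
  have hSne : Nonempty S := by
    by_contra hS
    rw [not_nonempty_iff] at hS
    apply hF0
    rw [h]
    exact Fintype.sum_empty _
  rcases Nat.eq_zero_or_pos n with hn | hn
  · subst hn
    have hN1 : N ≤ 1 := by
      rw [← hN, zero_add, Finset.sum_range_one]
      refine (Nat.sub_le _ _).trans ?_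
      haveI := finite_homogeneousSubmodule (K := K) (σ := Fin 0 × Fin 0) 0
      -- `S_0 = K · 1` has dimension `1`
      have h1 : homogeneousSubmodule (Fin 0 × Fin 0) K 0 ≤ Submodule.span K {(1 : MvPolynomial (Fin 0 × Fin 0) K)} := by
        intro D hD
        rw [mem_homogeneousSubmodule, ← totalDegree_zero_iff_isHomogeneous, totalDegree_eq_zero_iff_eq_C] at hD
        rw [hD, Submodule.mem_span_singleton]
        exact ⟨coeff 0 D, by rw [smul_eq_C_mul, mul_one]⟩
      haveI : Module.Finite K (Submodule.span K {(1 : MvPolynomial (Fin 0 × Fin 0) K)}) :=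
        Module.Finite.span_of_finite K (Set.finite_singleton _)
      exact (Submodule.finrank_mono h1).trans ((finrank_span_le_card _).trans (by simp))
    have : 1 ≤ Fintype.card S := Fintype.card_pos
    omega
  -- `n ≥ 1`: discard the zero points, choose a transverse diagonal quadric, apply the count
  let S' := {s : S // ℓ s ≠ 0}
  have h' : F = ∑ s : S', C (c s.1) * (∑ a, C (ℓ s.1 a) * X a) ^ n := by
    rw [h, ← Finset.sum_filter_of_ne (p := fun s => ℓ s ≠ 0), Finset.sum_subtype]
    · intro s; simp
    · intro s _ hs hs0
      apply hs
      rw [hs0]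
      simp [zero_pow hn.ne']
  obtain ⟨w, hw⟩ := exists_diag_quadric_eval_ne_zero K (fun s : S' => ℓ s.1) fun s => s.2
  set G : MvPolynomial (Fin n × Fin n) K := ∑ a, C (w a) * (X a * X a) with hGdef
  have hGhom : G.IsHomogeneous 2 := by
    refine IsHomogeneous.sum _ _ _ fun a _ => ?_
    have : (C (w a) * (X a * X a) : MvPolynomial (Fin n × Fin n) K).IsHomogeneous (0 + (1 + 1)) :=
      (isHomogeneous_C _ _).mul ((isHomogeneous_X K a).mul (isHomogeneous_X K a))
    simpa using this
  have hGann : G ∈ annihilatorIdeal F := by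
    refine hU (Ideal.sum_mem _ fun a _ => Ideal.mul_mem_left _ _ (Ideal.subset_span ⟨a, a, Or.inl rfl, rfl⟩))
  have hGeval : ∀ s : S', eval (ℓ s.1) G ≠ 0 := by
    intro s
    have : eval (ℓ s.1) G = ∑ a, w a * (ℓ s.1 a * ℓ s.1 a) := by
      simp [hGdef, map_sum, eval_C, eval_X]
    rw [this]
    exact hw s
  have hS'ne : Nonempty S' := by
    by_contra hS
    rw [not_nonempty_iff] at hS
    apply hF0
    rw [h']
    exact Fintype.sum_empty _
  have hG0 : G ≠ 0 := by
    obtain ⟨s⟩ := hS'ne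
    intro hG
    exact hGeval s (by rw [hG, map_zero])
  have hmain := sum_hilbertFunction_annihilatorIdeal_le_mul_card (fun s : S' => ℓ s.1) (fun s => c s.1)
    h' (by norm_num) hGhom hGann hGeval hG0 n
  rw [hN] at hmain
  exact hmain.trans (Nat.mul_le_mul_left 2 (Fintype.card_subtype_le _))

/-- **Shafiei 2015, Theorem 3.5 for the determinant (Waring-rank reading of
`½ binom(2n,n) ≤ cr(F) ≤ sr(F) ≤ r(F)`):** every Waring decomposition
`det_n = Σ_{s ∈ S} c_s ℓ_s^n` of the generic determinant over an infinite field uses at least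
`½ binom(2n,n)` powers of linear forms: `binom(2n,n) ≤ 2 |S|`. (Ranestad–Schreyer with `Ann(det_n)`
generated by quadrics, Thm. 2.12, and `Σ_k H(S/Ann(det A))_k = binom(2n,n)`, eq. (2.2); the printed
theorem bounds the cactus rank, a stronger scheme-theoretic statement not typed here.)
[cite: Shafiei2015, Theorem 3.5] [cite: RanestadSchreyer2011, Proposition 1] -/
theorem choose_le_two_mul_card_of_waring_detPoly [Infinite K] (n : ℕ)
    (ℓ : S → Fin n × Fin n → K) (c : S → K)
    (h : detPoly (Fin n) K = ∑ s, C (c s) * (∑ a, C (ℓ s a) * X a) ^ n) :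
    (2 * n).choose n ≤ 2 * Fintype.card S := by
  classical
  refine le_two_mul_card_of_waring K ?_ ?_ (sum_hilbertFunction_annihilatorIdeal_detPoly K n) ℓ c h
  · exact Matrix.det_mvPolynomialX_ne_zero (Fin n) K
  · rw [annihilatorIdeal_detPoly]
    exact Ideal.span_mono Set.subset_union_left

/-- **Shafiei 2015, Theorem 3.5 for the permanent (Waring-rank reading):** every Waring
decomposition `perm_n = Σ_{s ∈ S} c_s ℓ_s^n` over an infinite field has `binom(2n,n) ≤ 2 |S|`
("These are also lower bounds for the corresponding ranks of the permanent", Rem. 3.15 (a)).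
[cite: Shafiei2015, Theorem 3.5] [cite: RanestadSchreyer2011, Proposition 1] -/
theorem choose_le_two_mul_card_of_waring_perPoly [Infinite K] (n : ℕ)
    (ℓ : S → Fin n × Fin n → K) (c : S → K)
    (h : perPoly (Fin n) K = ∑ s, C (c s) * (∑ a, C (ℓ s a) * X a) ^ n) :
    (2 * n).choose n ≤ 2 * Fintype.card S := by
  classical
  refine le_two_mul_card_of_waring K ?_ ?_ (sum_hilbertFunction_annihilatorIdeal_perPoly K n) ℓ c h
  · exact perPoly_ne_zero (Fin n) K
  · rw [annihilatorIdeal_perPoly]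
    exact Ideal.span_mono Set.subset_union_left

end DetPerm

end Literature.Computability.AlgebraicComplexity
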